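import Literature.MathematicalPhysics.QuantumFieldTheory.Balaban1983to89.B15DeterminingSetsBBackgrounds

/-!
# `Balaban1983to89.B15DeterminingSetsBBackgroundsBridges` — [Balaban1989LargeFieldI] (= [B15]) (1.74), (1.77), Prop. 1, (1.79) OVER `(bg : DetBackgroundB, 𝔅 : BDetSet)`: THE THEOREMS
# (THEOREMS-ONLY companion of the statement-only module `B15DeterminingSetsBBackgrounds`)

statement-level skeleton of published theorems with citation tags; proofs where landed; nothing here is a claim about the
Yang–Mills mass gap

Cell `pub-ymgap` (HUMAN RULINGS D-0062 ∕ D-0149), lane `pub-ymgap-dag-n12-c` g34 (R134 seat (a), N12 = [B15], s1); `--kind proof --supports` K1⁹ `stmt-QuantumFields-27364`;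
count-neutral.  THEOREMS ONLY (0 `def`, 0 `instance`, 0 `sorry`).  HONESTY GUARD (director-ym №338 (5)): purely additive; the (b)-instance `B15DeterminingSets.wilsonAction4_bgU0_le`
stays landed and true on its own text; nothing elsewhere is edited.

WHAT IS HERE.
* §1 `wilsonAction4_bgU0B_le` ((1.79) + Prop. 1: `A(U₀) ≤` (1.77) at every competitor), `IsVLambdaB.eq_off`; `isMinimizerB_bgKZB` (the [III] (2.12) property of (1.74) on `bg.dom 𝔅` —
  the ONE place the Proposition-1 road reads `bg.isMinimizer`), `agreeOnB_bgKZB`, `bgKZB_mem_reg`.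
* §2 PRINT vs (b), the one general inequality between the two roads: a minimiser constrained on FEWER bonds has SMALLER action — `IsMinimizerB.wilsonAction4_le_of_anti` (`𝔅′ ⊆ 𝔅`
  levelwise, same data, same class) and its instances `wilsonAction4_U_lamBondsSeq_le_U_bondsDet_genSet` ∕ `fun177B_lamBondsSeq_le_fun177B_bondsDet_genSet` (print's [II] (2.3)
  minimiser vs the reading-(b) minimiser of the same solution map at the same data, both in the domain): `A(U(Λ, V)) ≤ A(U(𝐁^{(b)}, V))`.  FLAG №16's content is the converse
  failure (they differ in general); this is the only general comparison.

HONEST SCOPE.  Elementary bookkeeping; nothing of Bałaban's analysis asserted or proved; no named fact inhabited; count-neutral; N12 NOT discharged; K0⁷ ∕ K1⁹ NOT closed; the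
Yang–Mills mass gap (Clay) is NOT proved by any of this.

References: [B15] = [Balaban1989LargeFieldI] (1.74) p.192, (1.77)–(1.78) Prop. 1 p.194, (1.79) p.195; [III] = [Balaban1988Convergent] (2.10)–(2.13) pp.256–257; [II] =
[Balaban1984PropagatorsII] (2.3) p.224; [I] = [Balaban1987RG1] (0.1) p.251.
-/

open Set

namespace Literature.MathematicalPhysics.QuantumFieldTheory.Balaban1983to89.B15DeterminingSetsB

open B15DeterminingSets

variable {P : Params}

/-! ## §1  (1.79) + Prop. 1; the (2.12) property of (1.74) -/

section LocalBackgroundsB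

variable {G : Type*} [GaugeGroup G] {av : ∀ j, Averaging P j G} {bg : DetBackgroundB P G av} {k : ℕ}

/-- (1.79) with Proposition 1: `A(U₀)` is the minimum value of (1.77) over the fields agreeing with `V_k` off `Λ`, whenever `V_Λ` is its minimiser (twin of
`B15DeterminingSets.wilsonAction4_bgU0_le`). [cite: Balaban1989LargeFieldI, (1.79) p.195] -/
theorem wilsonAction4_bgU0B_le {𝔅 : BDetSet P} {Qs : GaugeField P k G → GaugeField P 0 G} {Λb : Set (PBond P k)} {Vout VΛ : GaugeField P k G}
    (hV : IsVLambdaB bg 𝔅 Qs Λb Vout VΛ) (W : GaugeField P k G) (hW : ∀ b, b ∉ Λb → W b = Vout b) :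
    wilsonAction4 (bgU0B bg 𝔅 Qs VΛ) ≤ fun177B bg 𝔅 Qs W :=
  hV.2 W hW

/-- A minimiser of (1.77) agrees with the frozen variables off `Λ`. [cite: Balaban1989LargeFieldI, Prop. 1 p.194 (bookkeeping)] -/
theorem IsVLambdaB.eq_off {𝔅 : BDetSet P} {Qs : GaugeField P k G → GaugeField P 0 G} {Λb : Set (PBond P k)} {Vout VΛ : GaugeField P k G}
    (hV : IsVLambdaB bg 𝔅 Qs Λb Vout VΛ) {b : PBond P k} (hb : b ∉ Λb) : VΛ b = Vout b :=
  hV.1 b hb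

/-- **THE [III] (2.12) PROPERTY OF (1.74) ON THE DOMAIN** — the one place the Proposition-1 road READS `bg.isMinimizer`: for data in `bg.dom 𝔅`, `U_{k,Z}(V_k)` minimises the action
over `bg.reg` among the configurations with the averages `M˙(Q^{s*}V_k)` on the bonds of `𝔅`. [cite: Balaban1989LargeFieldI, (1.74) p.192; Balaban1988Convergent, (2.12)–(2.13) pp.256–257] -/
theorem isMinimizerB_bgKZB {𝔅 : BDetSet P} {Qs : GaugeField P k G → GaugeField P 0 G} {Vk : GaugeField P k G} (hV : avgFamily av (Qs Vk) ∈ bg.dom 𝔅) :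
    IsMinimizerB av bg.reg 𝔅 (avgFamily av (Qs Vk)) (bgKZB bg 𝔅 Qs Vk) :=
  bg.isMinimizer _ _ hV

/-- On the domain, (1.74) satisfies its constraint on the bonds of `𝔅`. [cite: Balaban1989LargeFieldI, (1.74) p.192; Balaban1988Convergent, (2.10), (2.12) p.256] -/
theorem agreeOnB_bgKZB {𝔅 : BDetSet P} {Qs : GaugeField P k G → GaugeField P 0 G} {Vk : GaugeField P k G} (hV : avgFamily av (Qs Vk) ∈ bg.dom 𝔅) :
    AgreeOnB 𝔅 (avgFamily av (bgKZB bg 𝔅 Qs Vk)) (avgFamily av (Qs Vk)) :=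
  (isMinimizerB_bgKZB hV).agreeOnB

/-- On the domain, (1.74) lies in the regular class of the solution map. [cite: Balaban1989LargeFieldI, (1.74) p.192; Balaban1988Convergent, (2.12) p.256] -/
theorem bgKZB_mem_reg {𝔅 : BDetSet P} {Qs : GaugeField P k G → GaugeField P 0 G} {Vk : GaugeField P k G} (hV : avgFamily av (Qs Vk) ∈ bg.dom 𝔅) :
    bgKZB bg 𝔅 Qs Vk ∈ bg.reg :=
  (isMinimizerB_bgKZB hV).mem_reg

end LocalBackgroundsB

/-! ## §2  Print's (2.3) minimiser vs the reading-(b) minimiser of the same solution map: one inequality -/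

section Comparison

variable {G : Type*} [GaugeGroup G] {av : ∀ j, Averaging P j G}

/-- **FEWER CONSTRAINTS, SMALLER MINIMUM**: if `U₀` minimises over `reg` with the data `V` on `𝔅′`, `U₁` minimises over the same `reg` with the same data on `𝔅 ⊇ 𝔅′` (levelwise), then
`A(U₀) ≤ A(U₁)` — `U₁` satisfies the weaker constraint (F0a `AgreeOnB.anti`). [cite: Balaban1988Convergent, (2.10), (2.12) p.256] -/
theorem IsMinimizerB.wilsonAction4_le_of_anti {reg : Set (GaugeField P 0 G)} {𝔅 𝔅' : BDetSet P} (h𝔅 : ∀ j, 𝔅' j ⊆ 𝔅 j) {V : MSField P G} {U₀ U₁ : GaugeField P 0 G}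
    (h₀ : IsMinimizerB av reg 𝔅' V U₀) (h₁ : IsMinimizerB av reg 𝔅 V U₁) : wilsonAction4 U₀ ≤ wilsonAction4 U₁ :=
  h₀.le h₁.mem_reg (h₁.agreeOnB.anti h𝔅)

/-- **PRINT's [II] (2.3) MINIMISER HAS ACTION AT MOST THE READING-(b) MINIMISER's** (same bond-level solution map, same data `V` in both domains): `A(U(Λ(Ω, k), V)) ≤ A(U(𝐁^{(b)}(Ω, k),
V))`, since print's datum `lamBondsSeq Ω k` omits the inward connectors that reading (b) constrains (F0a `lamBondsSeq_subset_bondsDet`).  FLAG №16's content is that the two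
configurations differ in general; this is the only general comparison. [cite: Balaban1984PropagatorsII, (2.3) p.224; Balaban1987RG1, (0.1) p.251; Balaban1988Convergent, (2.12)–(2.13) pp.256–257] -/
theorem wilsonAction4_U_lamBondsSeq_le_U_bondsDet_genSet (bg : DetBackgroundB P G av) (Ω : ℕ → Set (Site P 0)) (k : ℕ) {V : MSField P G}
    (hVlam : V ∈ bg.dom (lamBondsSeq Ω k)) (hVb : V ∈ bg.dom (bondsDet (genSet Ω k))) :
    wilsonAction4 (bg.U (lamBondsSeq Ω k) V) ≤ wilsonAction4 (bg.U (bondsDet (genSet Ω k)) V) :=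
  (bg.isMinimizer _ _ hVlam).wilsonAction4_le_of_anti (lamBondsSeq_subset_bondsDet Ω k) (bg.isMinimizer _ _ hVb)

/-- The same for (1.74)∕(1.77): at data in both domains, the function (1.77) built on print's datum is pointwise at most the one built on the reading-(b) datum of the same `{Ω_j}`.
[cite: Balaban1989LargeFieldI, (1.74) p.192, (1.77) p.194; Balaban1984PropagatorsII, (2.3) p.224; Balaban1987RG1, (0.1) p.251] -/
theorem fun177B_lamBondsSeq_le_fun177B_bondsDet_genSet (bg : DetBackgroundB P G av) (Ω : ℕ → Set (Site P 0)) {k n : ℕ} (Qs : GaugeField P n G → GaugeField P 0 G)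
    (Vn : GaugeField P n G) (hVlam : avgFamily av (Qs Vn) ∈ bg.dom (lamBondsSeq Ω k)) (hVb : avgFamily av (Qs Vn) ∈ bg.dom (bondsDet (genSet Ω k))) :
    fun177B bg (lamBondsSeq Ω k) Qs Vn ≤ fun177B bg (bondsDet (genSet Ω k)) Qs Vn :=
  wilsonAction4_U_lamBondsSeq_le_U_bondsDet_genSet bg Ω k hVlam hVb

end Comparison

end Literature.MathematicalPhysics.QuantumFieldTheory.Balaban1983to89.B15DeterminingSetsB
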